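import Summits.QuantumFields.YangMills.Theorems.BalabanUVNodesN16ScalarFluxTransport
import HarnessLib

/-!
# YM-DAG node N16 (NE3), the re-keyed N07 in-edge — RANK ONE AND JENSEN: every `U(1)`-valued configuration has a real potential; the level action dominates its `(e₀,e₁)`-plane
# part; Jensen's inequality for the strictly concave `cos` on `[−π∕2, π∕2]` with its equality case (file 6a of the g6 piece; file 6b `…N16UniformScalarMinimisers` concludes)

Cell `pub-ymgap`, width seat `pub-ymgap-dag-n16-w2` (director-ym №197 ∕ HUMAN RULING D-0149), generation 6.  `--kind proof --supports stmt-QuantumFields-27366 --as helper`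
(K3⁸, KEY MAP v2).  `bears_on: R4∕N16`, edge N07 → N16.  COUNT-NEUTRAL.

HONEST FRAMING.  Elementary bookkeeping (rank-one matrices are scalars; non-negativity of the Wilson weight `MinimalActionLevels.wt_nonneg_of_unitary`; Mathlib's
`strictConcaveOn_cos_Icc`, `ConcaveOn.le_map_sum`, `StrictConcaveOn.map_sum_eq_iff`).  Nothing of Bałaban is asserted or refuted; DischargeTest `stub_reg910Slot` NOT closed; no K3⁸
v6 stub named or closed; N16 ∕ N07 NOT discharged; counts UNMOVED (typed 28∕28 · discharged 5∕27 · A 5∕28).  R4 closes the conditional finite-𝕋⁴ rung `BalabanLadder.UV` only;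
NOT ℝ⁴ ∕ OS ∕ mass gap; the YM mass gap (Clay) is NOT proved by any of this.

WHAT IS PROVED ([folklore], 0 `sorry`, 0 `def`).  §1 (`[Unique n]` = rank one) `matrix_eq_smul_one`, `exists_cexp_smul_one_of_unitary`, ★ `exists_real_presentation` (every
`U(1)`-valued configuration is `e^{iA}·1` for a REAL potential `A`).  §2 `sum_perWin_ge_plane01` (the period-window sum of Wilson weights dominates its `(e₀,e₁)`-plane part),
`wt_eq_zero_of_sum_perWin_eq` (if they are equal, every other plaquette of the period box weighs `0`), ★ `jensen_one_sub_cos` (`Σ_x (1 − cos θ_x) ≥ #s·(1 − cos θ̄)` for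
`|θ_x| ≤ π∕2`), ★ `jensen_one_sub_cos_eq_iff` (equality forces `θ_x = θ̄` for all `x`).

DEPENDENCES (by name): file 2 (`smul_one_inj`); `T4AveragingDeficitWallBoundary` (`scalarCfg`, `π₀`, `periodBox`); `T4AveragingDeficitWall` (`wt`, `fhol`); `MinimalActionLevels`
(`perWin`, `wt_nonneg_of_unitary`); `B7Prop2Explicit` (`hol_mem_of`, `mem_unitaryUnits`); `FederbushMean.cexp_smul_one`; Mathlib (`Unitary.star_mul_self_of_mem`,
`Complex.normSq_eq_conj_mul_self`, `Complex.normSq_eq_norm_sq`, `Complex.norm_mul_exp_arg_mul_I`, `strictConcaveOn_cos_Icc`, `Finset.single_le_sum`, `Finset.sum_eq_sum_iff_of_le`,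
`Finset.sum_eq_zero_iff_of_nonneg`).
-/

open scoped BigOperators Matrix Matrix.Norms.L2Operator
open NormedSpace Finset

namespace Summit.QuantumFields.YangMills.BalabanUVNodes.N16UniformScalarJensen

open Literature.MathematicalPhysics.QuantumFieldTheory.Balaban1983to89
open B7Prop1Explicit B7Prop2Explicit MatrixLog UnitaryModel
open T4AveragingDeficitWall hiding Site Plane Plaq Bond
open T4AveragingDeficitWallBoundary (scalarCfg periodBox π₀)
open FederbushMean (cexp_smul_one)
open Summit.QuantumFields.BalabanUV.T4Continuum
open MinimalActionLevels (perWin wt_nonneg_of_unitary)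
open Summit.QuantumFields.YangMills.BalabanUVNodes.N16UniformScalarSeam (smul_one_inj)

noncomputable section

variable {d : ℕ} {n : Type} [Fintype n] [DecidableEq n]

/-! ## §1 Rank one: every `U(1)`-valued configuration has a real potential -/

omit [Fintype n] in
/-- At rank one (`n` a one-element type) a matrix is the scalar `M₀₀ · 1`. [folklore] -/
theorem matrix_eq_smul_one [Unique n] (M : Matrix n n ℂ) : M = M default default • (1 : Matrix n n ℂ) := by
  ext i j
  rw [Subsingleton.elim i default, Subsingleton.elim j default]
  simp

/-- At rank one a unitary matrix is `e^{it}·1` for a real `t` (its argument). [folklore] -/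
theorem exists_cexp_smul_one_of_unitary [Unique n] {u : (Matrix n n ℂ)ˣ} (hu : u ∈ unitaryUnits (Matrix n n ℂ)) :
    ∃ t : ℝ, (u : Matrix n n ℂ) = Complex.exp (((t : ℝ) : ℂ) * Complex.I) • (1 : Matrix n n ℂ) := by
  set c : ℂ := (u : Matrix n n ℂ) default default with hc
  have hM := matrix_eq_smul_one (u : Matrix n n ℂ)
  have hstar := Unitary.star_mul_self_of_mem (mem_unitaryUnits.mp hu)
  rw [hM] at hstar
  rw [star_smul, star_one, smul_mul_smul_comm, one_mul] at hstar
  have hcc : star c * c = 1 := smul_one_inj (n := n) (by rw [hstar, one_smul])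
  have hnorm : ‖c‖ = 1 := by
    have h1 : ((Complex.normSq c : ℝ) : ℂ) = 1 := by
      rw [Complex.normSq_eq_conj_mul_self]; exact hcc
    have h2 : ‖c‖ ^ 2 = 1 := by
      rw [← Complex.normSq_eq_norm_sq]; exact_mod_cast h1
    nlinarith [norm_nonneg c]
  refine ⟨Complex.arg c, ?_⟩
  have h := Complex.norm_mul_exp_arg_mul_I c
  rw [hnorm, Complex.ofReal_one, one_mul] at h
  rw [h]; exact hM

/-- **★ RANK ONE: every `U(1)`-valued configuration is `e^{iA}·1` for a REAL potential `A`.** [folklore] -/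
theorem exists_real_presentation [Unique n] {U : B7Prop1Explicit.Site d → Fin d → (Matrix n n ℂ)ˣ} (hU : IsUnitaryCfg U) :
    ∃ A : B7Prop1Explicit.Site d → Fin d → ℝ, U = scalarCfg (n := n) (fun y ν => ((A y ν : ℝ) : ℂ) * Complex.I) := by
  choose A hA using fun x κ => exists_cexp_smul_one_of_unitary (hU x κ)
  refine ⟨A, funext fun x => funext fun κ => Units.ext ?_⟩
  rw [hA x κ, scalarCfg, val_expUnit, ← cexp_smul_one]

/-! ## §2 The `(e₀,e₁)`-plane part of the level action, and Jensen for `1 − cos` -/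

/-- **The level action dominates its `(e₀,e₁)`-plane part** (the other planes weigh `≥ 0` for `U(N)`-valued configurations). [cite: Balaban1985Variational, (5) p.278] -/
theorem sum_perWin_ge_plane01 [Nonempty n] {U : B7Prop1Explicit.Site (d + 2) → Fin (d + 2) → (Matrix n n ℂ)ˣ} (hU : IsUnitaryCfg U) (M : ℕ) :
    ∑ x ∈ periodBox M, wt (hol U x (plaqWord 0 1)) ≤ ∑ p ∈ perWin (d + 2) M, wt (fhol U p) := by
  rw [perWin, Finset.sum_product]
  refine Finset.sum_le_sum fun x _ => ?_
  have h := Finset.single_le_sum (f := fun π : T4AveragingDeficitWall.Plane (d + 2) => wt (fhol U (x, π)))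
    (fun π _ => wt_nonneg_of_unitary (hol_mem_of hU _ _)) (Finset.mem_univ (π₀ (d := d)))
  simpa [fhol, π₀] using h

/-- **If the level action EQUALS its `(e₀,e₁)`-plane part, every other plaquette of the period box weighs `0`.** [folklore] -/
theorem wt_eq_zero_of_sum_perWin_eq [Nonempty n] {U : B7Prop1Explicit.Site (d + 2) → Fin (d + 2) → (Matrix n n ℂ)ˣ} (hU : IsUnitaryCfg U) (M : ℕ)
    (heq : ∑ p ∈ perWin (d + 2) M, wt (fhol U p) = ∑ x ∈ periodBox M, wt (hol U x (plaqWord 0 1)))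
    {x : B7Prop1Explicit.Site (d + 2)} (hx : x ∈ periodBox M) {π : T4AveragingDeficitWall.Plane (d + 2)} (hπ : π ≠ π₀) : wt (fhol U (x, π)) = 0 := by
  rw [perWin, Finset.sum_product] at heq
  -- each inner sum is `≥` its `π₀` term, and the totals agree: so each inner sum equals its `π₀` term
  have hge : ∀ y ∈ periodBox M, wt (hol U y (plaqWord 0 1)) ≤ ∑ π : T4AveragingDeficitWall.Plane (d + 2), wt (fhol U (y, π)) := by
    intro y _
    have h := Finset.single_le_sum (f := fun π : T4AveragingDeficitWall.Plane (d + 2) => wt (fhol U (y, π)))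
      (fun π _ => wt_nonneg_of_unitary (hol_mem_of hU _ _)) (Finset.mem_univ (π₀ (d := d)))
    simpa [fhol, π₀] using h
  have hxeq := (Finset.sum_eq_sum_iff_of_le hge).mp heq.symm x hx
  -- in the inner sum at `x`, the `π₀` term exhausts the total, so the other (non-negative) terms vanish
  have hsplit := Finset.sum_erase_add (Finset.univ : Finset (T4AveragingDeficitWall.Plane (d + 2))) (fun π => wt (fhol U (x, π))) (Finset.mem_univ π₀)
  have h0 : wt (fhol U (x, π₀)) = wt (hol U x (plaqWord 0 1)) := by simp [fhol, π₀]
  rw [← hxeq, h0] at hsplit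
  have hrest : ∑ π ∈ Finset.univ.erase π₀, wt (fhol U (x, π)) = 0 := by linarith
  have hnn : ∀ π ∈ Finset.univ.erase (π₀ (d := d)), 0 ≤ wt (fhol U (x, π)) := fun π _ => wt_nonneg_of_unitary (hol_mem_of hU _ _)
  exact (Finset.sum_eq_zero_iff_of_nonneg hnn).mp hrest π (Finset.mem_erase.mpr ⟨hπ, Finset.mem_univ _⟩)

/-- **★ JENSEN FOR `1 − cos`**: for angles in `[−π∕2, π∕2]` on a non-empty finite set, `Σ_x (1 − cos θ_x) ≥ #s · (1 − cos θ̄)`, `θ̄ = (Σ_x θ_x)∕#s` (cos is concave there).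
[folklore] -/
theorem jensen_one_sub_cos {ι : Type*} (s : Finset ι) (hs : s.Nonempty) (θ : ι → ℝ) (hθ : ∀ x ∈ s, |θ x| ≤ Real.pi / 2) :
    (s.card : ℝ) * (1 - Real.cos ((∑ x ∈ s, θ x) / s.card)) ≤ ∑ x ∈ s, (1 - Real.cos (θ x)) := by
  have hcard : (0 : ℝ) < s.card := by exact_mod_cast hs.card_pos
  have hmem : ∀ x ∈ s, θ x ∈ Set.Icc (-(Real.pi / 2)) (Real.pi / 2) := fun x hx => by
    have := hθ x hx; rw [abs_le] at this; exact ⟨this.1, this.2⟩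
  have hJ := strictConcaveOn_cos_Icc.concaveOn.le_map_sum (t := s) (w := fun _ => (s.card : ℝ)⁻¹) (p := θ)
    (fun _ _ => by positivity) (by rw [Finset.sum_const, nsmul_eq_mul, mul_inv_cancel₀ hcard.ne']) hmem
  simp only [smul_eq_mul] at hJ
  rw [← Finset.mul_sum, ← Finset.mul_sum] at hJ
  rw [Finset.sum_sub_distrib, Finset.sum_const, nsmul_eq_mul, mul_one]
  have : (∑ x ∈ s, θ x) / s.card = (s.card : ℝ)⁻¹ * ∑ x ∈ s, θ x := by rw [div_eq_inv_mul]
  rw [this]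
  have h2 : (s.card : ℝ) * ((s.card : ℝ)⁻¹ * ∑ i ∈ s, Real.cos (θ i)) = ∑ i ∈ s, Real.cos (θ i) := by
    rw [← mul_assoc, mul_inv_cancel₀ hcard.ne', one_mul]
  nlinarith [mul_le_mul_of_nonneg_left hJ hcard.le]

/-- **★ … with equality iff all angles are equal to the mean** (cos is STRICTLY concave on `[−π∕2, π∕2]`). [folklore] -/
theorem jensen_one_sub_cos_eq_iff {ι : Type*} (s : Finset ι) (hs : s.Nonempty) (θ : ι → ℝ) (hθ : ∀ x ∈ s, |θ x| ≤ Real.pi / 2)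
    (heq : ∑ x ∈ s, (1 - Real.cos (θ x)) = (s.card : ℝ) * (1 - Real.cos ((∑ x ∈ s, θ x) / s.card))) :
    ∀ x ∈ s, θ x = (∑ y ∈ s, θ y) / s.card := by
  have hcard : (0 : ℝ) < s.card := by exact_mod_cast hs.card_pos
  have hmem : ∀ x ∈ s, θ x ∈ Set.Icc (-(Real.pi / 2)) (Real.pi / 2) := fun x hx => by
    have := hθ x hx; rw [abs_le] at this; exact ⟨this.1, this.2⟩
  have hJ := strictConcaveOn_cos_Icc.map_sum_eq_iff (t := s) (w := fun _ => (s.card : ℝ)⁻¹) (p := θ)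
    (fun _ _ => by positivity) (by rw [Finset.sum_const, nsmul_eq_mul, mul_inv_cancel₀ hcard.ne']) hmem
  simp only [smul_eq_mul] at hJ
  rw [← Finset.mul_sum, ← Finset.mul_sum] at hJ
  have hmean : (s.card : ℝ)⁻¹ * ∑ x ∈ s, θ x = (∑ y ∈ s, θ y) / s.card := by rw [div_eq_inv_mul]
  rw [hmean] at hJ
  have hcos : Real.cos ((∑ y ∈ s, θ y) / s.card) = (s.card : ℝ)⁻¹ * ∑ i ∈ s, Real.cos (θ i) := by
    rw [Finset.sum_sub_distrib, Finset.sum_const, nsmul_eq_mul, mul_one] at heq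
    have : ∑ i ∈ s, Real.cos (θ i) = (s.card : ℝ) * Real.cos ((∑ y ∈ s, θ y) / s.card) := by linarith
    rw [this, ← mul_assoc, inv_mul_cancel₀ hcard.ne', one_mul]
  exact hJ.mp hcos

end

end Summit.QuantumFields.YangMills.BalabanUVNodes.N16UniformScalarJensen
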